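import Summits.QuantumFields.YangMills.Theorems.UnitScaleTiltProp7FrameCorrectedMinusMeanL2
import Summits.QuantumFields.YangMills.Theorems.UnitScaleTiltProp7FrameResponseLinear
import Summits.QuantumFields.YangMills.Theorems.UnitScaleTiltProp7NestedMeanTowerClosenessT3
import HarnessLib

/-!
# Route `UnitScaleTilt`, crux K1 child «MinimiserStabilityRegPr» (stmt-QuantumFields-19200), skeleton v10, stub `stub_existenceMinimalOrbit` (EX), route (α) —
# **«P2CORE-OF-PLAQSMALL, FILE A» (px16 g4 LOCATE-HSPLIT-DESCENT v1.1 ecde23f5, cure (C1′) = ★px16 g3's (C1) ✓p682411 extended to the (P2-core)):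
# THE `U′`-REGULARITY HYPOTHESIS OF THE R2t ∕ ROW-V TOWER ROWS WEAKENED FROM `RegPr ε₀′ U′` TO ITS PLAQUETTE HALF `PlaqSmall (regThreshold F n K ε₀′) U′`** — re-exports, with the
# SAME proofs, of ★px6 g2's ✓`towerData_of_regPr` (R2t FILE B1), ✓`norm_frameResponse_sub_avgSeq_le_of_regPr` ∕ ✓`crs_frameResponse_sub_avgSeq_le_of_regPr` ∕
# ✓`sqrt_crs_frameResponse_le_of_regPr_of_avgSeq_eq_zero` ∕ ✓`norm_toL2S_shift_frameResponse_le_of_regPr_of_avgSeq_eq_zero` (R2t FILE B2) and ✓`exists_linear_frameResponse_of_regPr` (ROW-V)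
# — statements VERBATIM except `hreg′ ↦ hplaq′` at the chart point `U′` (the background `U₀` keeps `RegPr`); the ONE place `hreg′` was read (the `U1`-valuedness of the moving tower
# `Ū′⁽ʲ⁾`, ✓`emlIterU_bgUnits_mem_U1_of_regPr`) is served by ★px11's ✓`Prop7NestedMeanTowerCloseness.emlIterU_bgUnits_mem_U1_of_plaqSmall`; NO landed declaration is edited.
# WHY: [Balaban1985RegularSpaces] Sect. D reads only the PLAQUETTE regularity (1.7) of `U₁U₀` ((1.9) = `DivSmall` is its OUTPUT), and at the EX display S19ᴸ the (19)-size of the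
# chart exponent (which `RegPr U′` needs through `DivSmall`) is available only THROUGH the row `hSplit[Lift]` (✓`hSize19'_of_rowsL` ⟸ `hΔsol` ⟸ `h128Δ` ⟸ ✓p686481 ⟸ `hSplit[Lift]`),
# whereas `PlaqSmall` of the chart point follows from orders 0,1 alone (✓`plaqSmall_expHermField_of_orders01_le` ∘ ✓`orders01_of_eq111_T3`) — so the descent `hSplit[Lift] ↦
# ✓p671435` is ACYCLIC only in the `PlaqSmall` currency.  Files B (ROW-G, T4, T5), C (pairing, rows, three rows) and the all-members knit follow.

Cell `ym3-torus`, width seat `ym3-torus-px16` (gen 4).  THEOREMS ONLY (0 `def`, 0 `sorry`); `--supports stmt-QuantumFields-19200 --as helper`, count-neutral.  YM₃ on T³ is a ladder rung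
(R3), not the Clay problem; nothing here claims the stub, the crux, d = 4 or the mass gap.

References: T. Bałaban, CMP 98 (1985) 17–51 [Balaban1985Averaging] ((19) p.21, (58) p.27, (82) p.30, (97) p.32, (161)–(163) p.42); CMP 99 (1985) 389–434 [Balaban1985BackgroundPropagators]
((3.19) p.393, (3.114) p.418); CMP 102 (1985) 277–309 [Balaban1985Variational] ((2) p.278, (146) p.301); CMP 99 (1985) 75–102 [Balaban1985RegularSpaces] ((1.7)+(1.9) p.77, Sect. D pp.89–95).
-/

set_option autoImplicit false

noncomputable section

open scoped BigOperators Topology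
open Filter NormedSpace Metric
open scoped Matrix.Norms.L2Operator

namespace Summit.QuantumFields.YangMills.Theorems.Prop7FrameCorrectedMinusMean

open Literature.MathematicalPhysics.QuantumFieldTheory.Balaban1983to89
open T4Continuum BlockAveraging ExpMeanLog MatrixLog
open B10Eq27TorusAxialLog (holT gaugeActT gaugeActT_apply transl unitsField toUField)
open B7Prop1Explicit (expUnit val_expUnit disp U1 mem_U1)
open B7TransferAnalyticMean (meanCLM meanCLM_apply)
open Summit.QuantumFields.YangMills.Theorems.Prop7SymAvgTwSym (tstairU tstairU_def vframeCovU coe_vframeCovU dbarCovIterU frameAccU frameAccU_succ frameAccU_zero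
  dbarCovIterU_eq_gaugeActT_frameAccU norm_tstairU_sub_one_le_geom_of_regPr norm_dbarCovIterU_rel_sub_one_le_geom_of_regPr pow_mul_eta_le_one pow_mul_eta_eq_one
  holT_mem_U1 emlIterU_bgUnits_mem_U1_of_regPr)
open Summit.QuantumFields.YangMills.Theorems.Prop7TowerClosenessOfRegPr (frameAccU_bgUnits_mem_specialUnitaryGroup_of_regPr bgUnits_eq_expUnit_mul)
open Summit.QuantumFields.YangMills.Theorems.Prop7NestedMeanTowerCloseness (emlIterU_bgUnits_mem_U1_of_plaqSmall)
open Summit.QuantumFields.YangMills.Theorems.Prop8Chart (emlIterU)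
open B15DeterminingSets (embIter)
open B5Eq118OneStroke (iterBlockOf iterBlock mem_iterBlock iterBlock_zero sum_iterBlock_succ card_iterBlock)
open T3ContinuumYM3Torus
open T3PrintedRegularMinimiser (RegPr)
open T3RegularMinimiser (regThreshold)
open T3SectALandauChart (eta eta_pos bgUnits)
open B7Prop2SpecialUnitary (specialUnitaryUnits mem_specialUnitaryUnits specialUnitaryUnits_le_U1)
open Summit.QuantumFields.YangMills.Theorems.Prop7SectET3HilbertLetters (W₂ toL2S DL2)
open Summit.QuantumFields.YangMills.Theorems.Prop7NestedMeanPoincare (normSq_toL2S_eq)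
open Summit.QuantumFields.YangMills.Theorems.Prop7CovariantCoercivity (sum_norm_sq_le_mul_opNorm_sq)
open Summit.QuantumFields.YangMills.Theorems.Prop7SymFrameGaugeResponseAt (hasDerivAt_frameAccU_succ_at)
open T3LevelShift (siteShift)
open T3PrintedRegularOrbits (sites_eq)

variable (F : T3Family) {n K : ℕ}

/-- ★ **THE PER-LEVEL DATA OF THE R2t INDUCTION AT THE T³ MEMBER, FROM `RegPr` + THE CHART WINDOW.**  For `U₀ ∈ 𝔘_k(ε₀)` (`10¹²L³ε₀ ≤ 1`), `U′ = e^{A₁}U₀ ∈ 𝔘_k(ε₀′)` (`10⁷L³ε₀′ ≤ 1`),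
`‖A₁‖ < e·η` (`10⁹L²e ≤ 1`) and every level `j < K − n`: the stair transporters are within **`δτ_j := 60L·c·(Lʲη)`** of `1` (✓`norm_tstairU_sub_one_le_geom_of_regPr`), the accumulated frames
and their inverses within **`δν_j := 6·(5L)·c·(Lʲη)`** (✓`norm_dbarCovIterU_rel_sub_one_le_geom_of_regPr`), `c := 2e + 2700Lε₀`, and the frames, the one-level frames, the stair holonomies of
the moving tower `D̄_j = (Ū′⁽ʲ⁾)^{ν_j⁻¹}` (✓`dbarCovIterU_eq_gaugeActT_frameAccU`; `Ū′⁽ʲ⁾` is `U1` by ✓`emlIterU_bgUnits_mem_U1_of_regPr` at `U′`) and of the background tower `Ū₀⁽ʲ⁾` are all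
CONTRACTIVE (`SU(2)`: ✓`frameAccU_bgUnits_mem_specialUnitaryGroup_of_regPr`, ✓`holT_mem_U1`). [cite: Balaban1985Averaging, (58) p.27, (82) p.30, (97) p.32, (161)-(163) p.42; Balaban1985Variational, (2) p.278] -/
theorem towerData_of_plaqSmall {ε₀ ε₀' e : ℝ} (hε₀ : 0 < ε₀) (he : 0 < e) (hWe : 10 ^ 9 * (F.L : ℝ) ^ 2 * e ≤ 1) (hWε : 10 ^ 12 * (F.L : ℝ) ^ 3 * ε₀ ≤ 1)
    (hε₀' : 0 < ε₀') (hε' : 10 ^ 7 * (F.L : ℝ) ^ 3 * ε₀' ≤ 1)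
    (U₀ U' : GaugeField (F.P K) 0 (Matrix.specialUnitaryGroup (Fin 2) ℂ)) (hreg : RegPr F n K ε₀ U₀) (hplaq' : PlaqSmall (regThreshold F n K ε₀') U')
    (A₁ : PBond (F.P K) 0 → Matrix (Fin 2) (Fin 2) ℂ) (hA₁ : ‖A₁‖ < e * eta F n K)
    (hU' : ∀ b, ((U' b : Matrix.specialUnitaryGroup (Fin 2) ℂ) : Matrix (Fin 2) (Fin 2) ℂ) = exp (A₁ b) * ((U₀ b : Matrix.specialUnitaryGroup (Fin 2) ℂ) : Matrix (Fin 2) (Fin 2) ℂ)) :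
    (∀ (j : ℕ) (y : Site (F.P K) (j + 1)), j < K - n →
        ‖(fun i : Idx (F.P K) => ((tstairU (emlIterU j (bgUnits F K U₀)) (dbarCovIterU j (bgUnits F K U₀) (bgUnits F K U')) y i : (Matrix (Fin 2) (Fin 2) ℂ)ˣ) :
          Matrix (Fin 2) (Fin 2) ℂ)) - 1‖ ≤ 60 * (F.L : ℝ) * ((2 * e + 2700 * (F.L : ℝ) * ε₀) * ((F.L : ℝ) ^ j * eta F n K))) ∧
    (∀ (j : ℕ) (x : Site (F.P K) j), j < K - n → ‖((frameAccU j (bgUnits F K U₀) (bgUnits F K U') x : (Matrix (Fin 2) (Fin 2) ℂ)ˣ) : Matrix (Fin 2) (Fin 2) ℂ)‖ ≤ 1) ∧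
    (∀ (j : ℕ) (x : Site (F.P K) j), j < K - n → ‖(((frameAccU j (bgUnits F K U₀) (bgUnits F K U') x)⁻¹ : (Matrix (Fin 2) (Fin 2) ℂ)ˣ) : Matrix (Fin 2) (Fin 2) ℂ)‖ ≤ 1) ∧
    (∀ (j : ℕ) (x : Site (F.P K) j), j < K - n →
        ‖((frameAccU j (bgUnits F K U₀) (bgUnits F K U') x : (Matrix (Fin 2) (Fin 2) ℂ)ˣ) : Matrix (Fin 2) (Fin 2) ℂ) - 1‖ ≤
          6 * (5 * (F.L : ℝ)) * ((2 * e + 2700 * (F.L : ℝ) * ε₀) * ((F.L : ℝ) ^ j * eta F n K))) ∧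
    (∀ (j : ℕ) (x : Site (F.P K) j), j < K - n →
        ‖(((frameAccU j (bgUnits F K U₀) (bgUnits F K U') x)⁻¹ : (Matrix (Fin 2) (Fin 2) ℂ)ˣ) : Matrix (Fin 2) (Fin 2) ℂ) - 1‖ ≤
          6 * (5 * (F.L : ℝ)) * ((2 * e + 2700 * (F.L : ℝ) * ε₀) * ((F.L : ℝ) ^ j * eta F n K))) ∧
    (∀ (j : ℕ) (y : Site (F.P K) (j + 1)), j < K - n →
        ‖(((vframeCovU (emlIterU j (bgUnits F K U₀)) (dbarCovIterU j (bgUnits F K U₀) (bgUnits F K U')) y)⁻¹ : (Matrix (Fin 2) (Fin 2) ℂ)ˣ) : Matrix (Fin 2) (Fin 2) ℂ)‖ ≤ 1) ∧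
    (∀ (j : ℕ) (y : Site (F.P K) (j + 1)) (i : Idx (F.P K)), j < K - n →
        ‖((holT (dbarCovIterU j (bgUnits F K U₀) (bgUnits F K U')) (emb y) (stairWord i.2.1 (off i.1)) : (Matrix (Fin 2) (Fin 2) ℂ)ˣ) : Matrix (Fin 2) (Fin 2) ℂ)‖ ≤ 1) ∧
    (∀ (j : ℕ) (y : Site (F.P K) (j + 1)) (i : Idx (F.P K)), j < K - n →
        ‖(((holT (dbarCovIterU j (bgUnits F K U₀) (bgUnits F K U')) (emb y) (stairWord i.2.1 (off i.1)))⁻¹ : (Matrix (Fin 2) (Fin 2) ℂ)ˣ) : Matrix (Fin 2) (Fin 2) ℂ)‖ ≤ 1) ∧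
    (∀ (j : ℕ) (y : Site (F.P K) (j + 1)) (i : Idx (F.P K)), j < K - n →
        ‖((holT (emlIterU j (bgUnits F K U₀)) (emb y) (stairWord i.2.1 (off i.1)) : (Matrix (Fin 2) (Fin 2) ℂ)ˣ) : Matrix (Fin 2) (Fin 2) ℂ)‖ ≤ 1) ∧
    (∀ (j : ℕ) (y : Site (F.P K) (j + 1)) (i : Idx (F.P K)), j < K - n →
        ‖(((holT (emlIterU j (bgUnits F K U₀)) (emb y) (stairWord i.2.1 (off i.1)))⁻¹ : (Matrix (Fin 2) (Fin 2) ℂ)ˣ) : Matrix (Fin 2) (Fin 2) ℂ)‖ ≤ 1) := by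
  have hε7 : 10 ^ 7 * (F.L : ℝ) ^ 3 * ε₀ ≤ 1 := by
    have h1 : (0 : ℝ) ≤ (F.L : ℝ) ^ 3 * ε₀ := by positivity
    nlinarith
  have hA₁b : ∀ b, ‖A₁ b‖ ≤ e * eta F n K := fun b => (norm_le_pi_norm A₁ b).trans hA₁.le
  have hW : bgUnits F K U' = fun b => expUnit (A₁ b) * bgUnits F K U₀ b := bgUnits_eq_expUnit_mul F U₀ U' A₁ hU'
  -- frames are special unitary, hence contractive
  have hνsu : ∀ (j : ℕ) (x : Site (F.P K) j), j < K - n →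
      ‖((frameAccU j (bgUnits F K U₀) (bgUnits F K U') x : (Matrix (Fin 2) (Fin 2) ℂ)ˣ) : Matrix (Fin 2) (Fin 2) ℂ)‖ ≤ 1 ∧
      ‖(((frameAccU j (bgUnits F K U₀) (bgUnits F K U') x)⁻¹ : (Matrix (Fin 2) (Fin 2) ℂ)ˣ) : Matrix (Fin 2) (Fin 2) ℂ)‖ ≤ 1 := fun j x hj =>
    norm_le_one_of_mem_specialUnitaryGroup (frameAccU_bgUnits_mem_specialUnitaryGroup_of_regPr F hε₀ he hWe hWε U₀ U' hreg A₁ hA₁ hU' hj.le x)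
  have hνsu' : ∀ (j : ℕ) (x : Site (F.P K) j), j ≤ K - n →
      ‖((frameAccU j (bgUnits F K U₀) (bgUnits F K U') x : (Matrix (Fin 2) (Fin 2) ℂ)ˣ) : Matrix (Fin 2) (Fin 2) ℂ)‖ ≤ 1 ∧
      ‖(((frameAccU j (bgUnits F K U₀) (bgUnits F K U') x)⁻¹ : (Matrix (Fin 2) (Fin 2) ℂ)ˣ) : Matrix (Fin 2) (Fin 2) ℂ)‖ ≤ 1 := fun j x hj =>
    norm_le_one_of_mem_specialUnitaryGroup (frameAccU_bgUnits_mem_specialUnitaryGroup_of_regPr F hε₀ he hWe hWε U₀ U' hreg A₁ hA₁ hU' hj x)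
  -- the two towers are `U1`-valued
  have hQ1 : ∀ (j : ℕ), j < K - n → ∀ b : PBond (F.P K) j, emlIterU j (bgUnits F K U₀) b ∈ U1 (Matrix (Fin 2) (Fin 2) ℂ) := fun j hj b =>
    emlIterU_bgUnits_mem_U1_of_regPr F hε₀ hε7 hreg hj.le b
  have hP1 : ∀ (j : ℕ), j < K - n → ∀ b : PBond (F.P K) j, dbarCovIterU j (bgUnits F K U₀) (bgUnits F K U') b ∈ U1 (Matrix (Fin 2) (Fin 2) ℂ) := by
    intro j hj b
    rw [dbarCovIterU_eq_gaugeActT_frameAccU, gaugeActT_apply]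
    refine (U1 _).mul_mem ((U1 _).mul_mem ?_ (emlIterU_bgUnits_mem_U1_of_plaqSmall F hε₀' hε' U' hplaq' hj.le b)) ?_
    · exact mem_U1.2 ⟨(hνsu j _ hj).2, by rw [inv_inv]; exact (hνsu j _ hj).1⟩
    · rw [inv_inv]; exact mem_U1.2 ⟨(hνsu j _ hj).1, (hνsu j _ hj).2⟩
  refine ⟨fun j y hj => ?_, fun j x hj => (hνsu j x hj).1, fun j x hj => (hνsu j x hj).2, fun j x hj => ?_, fun j x hj => ?_, fun j y hj => ?_,
    fun j y i hj => (mem_U1.1 (holT_mem_U1 (hP1 j hj) _ _)).1, fun j y i hj => (mem_U1.1 (holT_mem_U1 (hP1 j hj) _ _)).2,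
    fun j y i hj => (mem_U1.1 (holT_mem_U1 (hQ1 j hj) _ _)).1, fun j y i hj => (mem_U1.1 (holT_mem_U1 (hQ1 j hj) _ _)).2⟩
  · -- stairs, in the sup norm over `Idx`
    have hη := eta_pos F n K
    refine (pi_norm_le_iff_of_nonneg (by positivity)).2 fun i => ?_
    have h := norm_tstairU_sub_one_le_geom_of_regPr F hε₀ he.le hWe hWε U₀ hreg A₁ hA₁b hj y i
    rw [← hW] at h
    simpa only [Pi.sub_apply, Pi.one_apply] using h
  · -- frames
    have h := (norm_dbarCovIterU_rel_sub_one_le_geom_of_regPr F hε₀ he.le hWe hWε U₀ hreg A₁ hA₁b hj.le (⟨x, ⟨0, (F.P K).hd⟩⟩ : PBond (F.P K) j)).2.1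
    rw [← hW] at h
    exact h
  · -- inverse frames
    have h := (norm_dbarCovIterU_rel_sub_one_le_geom_of_regPr F hε₀ he.le hWe hWε U₀ hreg A₁ hA₁b hj.le (⟨x, ⟨0, (F.P K).hd⟩⟩ : PBond (F.P K) j)).2.1
    rw [← hW] at h
    exact (norm_inv_sub_one_le _ (hνsu j x hj).2).trans h
  · -- one-level frames: `w_j(y) = ν_j(ŷ)⁻¹·ν_{j+1}(y)`
    have hsucc : vframeCovU (emlIterU j (bgUnits F K U₀)) (dbarCovIterU j (bgUnits F K U₀) (bgUnits F K U')) y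
        = (frameAccU j (bgUnits F K U₀) (bgUnits F K U') (emb y))⁻¹ * frameAccU (j + 1) (bgUnits F K U₀) (bgUnits F K U') y := by
      rw [frameAccU_succ, inv_mul_cancel_left]
    rw [hsucc, mul_inv_rev, inv_inv, Units.val_mul]
    have h1 := (hνsu' (j + 1) y (by omega)).2
    have h2 := (hνsu j (emb y) hj).1
    calc _ ≤ ‖(((frameAccU (j + 1) (bgUnits F K U₀) (bgUnits F K U') y)⁻¹ : (Matrix (Fin 2) (Fin 2) ℂ)ˣ) : Matrix (Fin 2) (Fin 2) ℂ)‖ *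
          ‖((frameAccU j (bgUnits F K U₀) (bgUnits F K U') (emb y) : (Matrix (Fin 2) (Fin 2) ℂ)ˣ) : Matrix (Fin 2) (Fin 2) ℂ)‖ := norm_mul_le _ _
      _ ≤ 1 * 1 := by gcongr
      _ = 1 := one_mul 1

/-- ★★★ **R2t, POINTWISE AT THE T³ MEMBER: `‖𝓚_{A₁}N(y) − ns_{K−n}(y)‖ ≤ δ_T · RMS_{B^{K−n}(y)}(N)`** for every displayed `δ_T ≥ 2(240L + 19560L³)(2e + 2700Lε₀)∕(L − 1)`
(`δ_T := 3∕10⁴` by `deltaT_le` under the windows of record, `3∕10⁶` by `deltaT_le_tight` under `10¹¹L²e ≤ 1`, `10¹⁴L³ε₀ ≤ 1`).  For `U₀ ∈ 𝔘_k(ε₀)` (`10¹²L³ε₀ ≤ 1`), `U′ = e^{A₁}U₀ ∈ 𝔘_k(ε₀′)`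
(`10⁷L³ε₀′ ≤ 1`), `‖A₁‖ < e·η` (`10⁹L²e ≤ 1`), any gauge family `g_t` through `1` with site derivative `N`, any averaging sequence `ns` of `N` against `Ū₀♭` (the letters of
✓`QTwS_gaugeDir_of_avgSeq`, so `𝓚₀N = ns_{K−n}` by ✓`hasDerivAt_frameAccU_of_avgSeq`) and EVERY derivative letter `V` of the accumulated frames along `(U′♭)^{g_t}` at the top level
(✓`exists_frameCorrected_eq`'s letters): the frame-corrected value minus the nested covariant mean is bounded by `δ_T` times the block RMS of `N` — `η`-free, no smoothness of `N`, no loop row.  ✓`frameResponse_norm_sub_avgSeq_le` with §6's data, the block-RMS majorant (`S = L²`) and §7's `ε`. [cite: Balaban1985Averaging, (97) p.32, (82) p.30, (161)-(163) p.42; Balaban1985BackgroundPropagators, (3.19) p.393, (3.21) p.394; Balaban1985Variational, (2) p.278, (45) p.285] -/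
theorem norm_frameResponse_sub_avgSeq_le_of_plaqSmall {ε₀ ε₀' e : ℝ} (hε₀ : 0 < ε₀) (he : 0 < e) (hWe : 10 ^ 9 * (F.L : ℝ) ^ 2 * e ≤ 1) (hWε : 10 ^ 12 * (F.L : ℝ) ^ 3 * ε₀ ≤ 1)
    (hε₀' : 0 < ε₀') (hε' : 10 ^ 7 * (F.L : ℝ) ^ 3 * ε₀' ≤ 1)
    (U₀ U' : GaugeField (F.P K) 0 (Matrix.specialUnitaryGroup (Fin 2) ℂ)) (hreg : RegPr F n K ε₀ U₀) (hplaq' : PlaqSmall (regThreshold F n K ε₀') U')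
    (A₁ : PBond (F.P K) 0 → Matrix (Fin 2) (Fin 2) ℂ) (hA₁ : ‖A₁‖ < e * eta F n K)
    (hU' : ∀ b, ((U' b : Matrix.specialUnitaryGroup (Fin 2) ℂ) : Matrix (Fin 2) (Fin 2) ℂ) = exp (A₁ b) * ((U₀ b : Matrix.specialUnitaryGroup (Fin 2) ℂ) : Matrix (Fin 2) (Fin 2) ℂ))
    {g : ℝ → Site (F.P K) 0 → (Matrix (Fin 2) (Fin 2) ℂ)ˣ} {N : Site (F.P K) 0 → Matrix (Fin 2) (Fin 2) ℂ} (hg0 : g 0 = fun _ => 1)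
    (hgd : ∀ x, HasDerivAt (fun t : ℝ => ((g t x : (Matrix (Fin 2) (Fin 2) ℂ)ˣ) : Matrix (Fin 2) (Fin 2) ℂ)) (N x) 0)
    (ns : (j : ℕ) → Site (F.P K) j → Matrix (Fin 2) (Fin 2) ℂ) (h0 : ns 0 = N)
    (hsucc : ∀ (j : ℕ) (y : Site (F.P K) (j + 1)), ns (j + 1) y = ns j (emb y) - meanCLM (Idx (F.P K)) (Matrix (Fin 2) (Fin 2) ℂ) fun i : Idx (F.P K) =>
        ns j (emb y) - ((holT (emlIterU j (bgUnits F K U₀)) (emb y) (stairWord i.2.1 (off i.1)) : (Matrix (Fin 2) (Fin 2) ℂ)ˣ) : Matrix (Fin 2) (Fin 2) ℂ) *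
          ns j (transl (emb y) (disp (stairWord i.2.1 (off i.1)))) * (((holT (emlIterU j (bgUnits F K U₀)) (emb y) (stairWord i.2.1 (off i.1)))⁻¹ : (Matrix (Fin 2) (Fin 2) ℂ)ˣ) : Matrix (Fin 2) (Fin 2) ℂ))
    {V : Site (F.P K) (K - n) → Matrix (Fin 2) (Fin 2) ℂ}
    (hV : ∀ x : Site (F.P K) (K - n), HasDerivAt (fun t : ℝ => ((frameAccU (K - n) (bgUnits F K U₀) (gaugeActT (g t) (bgUnits F K U')) x : (Matrix (Fin 2) (Fin 2) ℂ)ˣ) : Matrix (Fin 2) (Fin 2) ℂ)) (V x) 0)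
    {δT : ℝ} (hδT : 2 * (240 * (F.L : ℝ) + 19560 * (F.L : ℝ) ^ 3) * (2 * e + 2700 * (F.L : ℝ) * ε₀) / ((F.L : ℝ) - 1) ≤ δT)
    (y : Site (F.P K) (K - n)) :
    ‖(N (embIter (K - n) y) - V y * (((frameAccU (K - n) (bgUnits F K U₀) (bgUnits F K U') y)⁻¹ : (Matrix (Fin 2) (Fin 2) ℂ)ˣ) : Matrix (Fin 2) (Fin 2) ℂ)) - ns (K - n) y‖
      ≤ δT * Real.sqrt (((((F.P K).L : ℝ) ^ (F.P K).d) ^ (K - n))⁻¹ * ∑ x ∈ iterBlock (K - n) y, ‖N x‖ ^ 2) := by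
  obtain ⟨hτ, hν, hν', hν1, hν1', hw', hP, hP', hQ, hQ'⟩ := towerData_of_plaqSmall F hε₀ he hWe hWε hε₀' hε' U₀ U' hreg hplaq' A₁ hA₁ hU'
  obtain ⟨hε, hεle, hεsucc⟩ := epsSeq_rows F (n := n) (K := K) hε₀ he.le hWe hWε
  have hLL : ((F.P K).L : ℝ) = F.L := rfl
  have hd : (F.P K).d = 3 := T3Family.P_d F K
  have hL3 : 3 ≤ F.L := by obtain ⟨a, ha⟩ := F.hL.1; have := F.hL.2; omega
  have hL1 : (1 : ℝ) ≤ F.L := by exact_mod_cast (show 1 ≤ F.L by omega)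
  have hη : 0 < eta F n K := eta_pos F n K
  have hS : ((F.P K).L : ℝ) ^ (F.P K).d ≤ ((F.L : ℝ) ^ 2) ^ 2 := by
    rw [hLL, hd, ← pow_mul]; exact pow_le_pow_right₀ hL1 (by norm_num)
  have hmK : ∀ j, j < K - n → j + 1 ≤ (F.P K).m + (F.P K).K := fun j hj => by
    show j + 1 ≤ F.m + K; have := F.hm; omega
  -- `δτ_j ≤ 1∕24`
  have hδτ : ∀ j, j < K - n → 60 * (F.L : ℝ) * ((2 * e + 2700 * (F.L : ℝ) * ε₀) * ((F.L : ℝ) ^ j * eta F n K)) ≤ 1 / 24 := by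
    intro j hj
    have hX : (F.L : ℝ) ^ j * eta F n K ≤ 1 := pow_mul_eta_le_one F hj.le
    have hu : (F.L : ℝ) ^ 2 * e ≤ 1 / 10 ^ 9 := by rw [le_div_iff₀ (by positivity)]; linarith
    have hv : (F.L : ℝ) ^ 3 * ε₀ ≤ 1 / 10 ^ 12 := by rw [le_div_iff₀ (by positivity)]; linarith
    have h1 : (F.L : ℝ) * e ≤ (F.L : ℝ) ^ 2 * e := mul_le_mul_of_nonneg_right (le_self_pow₀ hL1 two_ne_zero) he.le
    have h2 : (F.L : ℝ) ^ 2 * ε₀ ≤ (F.L : ℝ) ^ 3 * ε₀ := mul_le_mul_of_nonneg_right (pow_le_pow_right₀ hL1 (by norm_num)) hε₀.le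
    calc 60 * (F.L : ℝ) * ((2 * e + 2700 * (F.L : ℝ) * ε₀) * ((F.L : ℝ) ^ j * eta F n K))
        ≤ 60 * (F.L : ℝ) * ((2 * e + 2700 * (F.L : ℝ) * ε₀) * 1) := by gcongr
      _ = 120 * ((F.L : ℝ) * e) + 162000 * ((F.L : ℝ) ^ 2 * ε₀) := by ring
      _ ≤ 1 / 24 := by linarith
  have hmain := frameResponse_norm_sub_avgSeq_le (bgUnits F K U₀) (bgUnits F K U') hg0 hgd ns h0 hsucc (K - n)
    (fun j => 60 * (F.L : ℝ) * ((2 * e + 2700 * (F.L : ℝ) * ε₀) * ((F.L : ℝ) ^ j * eta F n K)))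
    (fun j => 6 * (5 * (F.L : ℝ)) * ((2 * e + 2700 * (F.L : ℝ) * ε₀) * ((F.L : ℝ) ^ j * eta F n K)))
    (fun j => 2 * ∑ i ∈ Finset.range j, (240 * (F.L : ℝ) + 19560 * (F.L : ℝ) ^ 3) * ((2 * e + 2700 * (F.L : ℝ) * ε₀) * ((F.L : ℝ) ^ i * eta F n K)))
    (S := (F.L : ℝ) ^ 2) (by positivity) hδτ hτ hν hν' hν1 hν1' hw' hP hP' hQ hQ'
    (fun j z => Real.sqrt (((((F.P K).L : ℝ) ^ (F.P K).d) ^ j)⁻¹ * ∑ x ∈ iterBlock j z, ‖N x‖ ^ 2))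
    (fun j z => Real.sqrt_nonneg _) (fun x => (blockRMS_zero N x).symm.le)
    (fun j y' hj => mean_blockRMS_le (hmK j hj) N y')
    (fun j y' i hj => blockRMS_le_of_blockOf_eq N (by positivity) hS y' _ (Site.blockOf_blockSite (hmK j hj) y' i.1))
    (fun j y' hj => blockRMS_le_of_blockOf_eq N (by positivity) hS y' _ (Site.blockOf_emb (hmK j hj) y'))
    hε hεsucc le_rfl hV y
  exact hmain.trans (mul_le_mul_of_nonneg_right ((hεle _ le_rfl).trans hδT) (Real.sqrt_nonneg _))

/-- ★★★ **R2t IN THE COARSE-`ℓ²` CURRENCY OF RECORD (squared and `Real.sqrt` forms, ALL `N`)**: under the hypotheses of `norm_frameResponse_sub_avgSeq_le_of_regPr`,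
**`c₀·η⁻³·Σ_y Σ_{jk} |(𝓚_{A₁}N − ns_{K−n})(y)_{jk}|² ≤ 2·δ_T²·‖toL2S F K c₀ N‖²`** and `√(…) ≤ √2·δ_T·‖toL2S F K c₀ N‖` (displayed letter `δ_T`, `hδT`) — the row `hKT` of ✓`hS_of_rowsZ` (`δ = √2·δ_T`) once
`ns_{K−n} = 0` on the sector (`crs_frameResponse_le_of_regPr_of_avgSeq_eq_zero`). [cite: Balaban1985BackgroundPropagators, (3.11) p.392, (3.19) p.393, (3.21)-(3.23) p.394; Balaban1985Averaging, (97) p.32; Balaban1985Variational, (45) p.285] -/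
theorem crs_frameResponse_sub_avgSeq_le_of_plaqSmall {ε₀ ε₀' e : ℝ} (hε₀ : 0 < ε₀) (he : 0 < e) (hWe : 10 ^ 9 * (F.L : ℝ) ^ 2 * e ≤ 1) (hWε : 10 ^ 12 * (F.L : ℝ) ^ 3 * ε₀ ≤ 1)
    (hε₀' : 0 < ε₀') (hε' : 10 ^ 7 * (F.L : ℝ) ^ 3 * ε₀' ≤ 1)
    (U₀ U' : GaugeField (F.P K) 0 (Matrix.specialUnitaryGroup (Fin 2) ℂ)) (hreg : RegPr F n K ε₀ U₀) (hplaq' : PlaqSmall (regThreshold F n K ε₀') U')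
    (A₁ : PBond (F.P K) 0 → Matrix (Fin 2) (Fin 2) ℂ) (hA₁ : ‖A₁‖ < e * eta F n K)
    (hU' : ∀ b, ((U' b : Matrix.specialUnitaryGroup (Fin 2) ℂ) : Matrix (Fin 2) (Fin 2) ℂ) = exp (A₁ b) * ((U₀ b : Matrix.specialUnitaryGroup (Fin 2) ℂ) : Matrix (Fin 2) (Fin 2) ℂ))
    {g : ℝ → Site (F.P K) 0 → (Matrix (Fin 2) (Fin 2) ℂ)ˣ} {N : Site (F.P K) 0 → Matrix (Fin 2) (Fin 2) ℂ} (hg0 : g 0 = fun _ => 1)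
    (hgd : ∀ x, HasDerivAt (fun t : ℝ => ((g t x : (Matrix (Fin 2) (Fin 2) ℂ)ˣ) : Matrix (Fin 2) (Fin 2) ℂ)) (N x) 0)
    (ns : (j : ℕ) → Site (F.P K) j → Matrix (Fin 2) (Fin 2) ℂ) (h0 : ns 0 = N)
    (hsucc : ∀ (j : ℕ) (y : Site (F.P K) (j + 1)), ns (j + 1) y = ns j (emb y) - meanCLM (Idx (F.P K)) (Matrix (Fin 2) (Fin 2) ℂ) fun i : Idx (F.P K) =>
        ns j (emb y) - ((holT (emlIterU j (bgUnits F K U₀)) (emb y) (stairWord i.2.1 (off i.1)) : (Matrix (Fin 2) (Fin 2) ℂ)ˣ) : Matrix (Fin 2) (Fin 2) ℂ) *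
          ns j (transl (emb y) (disp (stairWord i.2.1 (off i.1)))) * (((holT (emlIterU j (bgUnits F K U₀)) (emb y) (stairWord i.2.1 (off i.1)))⁻¹ : (Matrix (Fin 2) (Fin 2) ℂ)ˣ) : Matrix (Fin 2) (Fin 2) ℂ))
    {V : Site (F.P K) (K - n) → Matrix (Fin 2) (Fin 2) ℂ}
    (hV : ∀ x : Site (F.P K) (K - n), HasDerivAt (fun t : ℝ => ((frameAccU (K - n) (bgUnits F K U₀) (gaugeActT (g t) (bgUnits F K U')) x : (Matrix (Fin 2) (Fin 2) ℂ)ˣ) : Matrix (Fin 2) (Fin 2) ℂ)) (V x) 0)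
    {δT : ℝ} (hδT : 2 * (240 * (F.L : ℝ) + 19560 * (F.L : ℝ) ^ 3) * (2 * e + 2700 * (F.L : ℝ) * ε₀) / ((F.L : ℝ) - 1) ≤ δT)
    {c₀ : ℝ} [Fact (0 < c₀)] :
    c₀ * (eta F n K)⁻¹ ^ 3 * ∑ y : Site (F.P K) (K - n), ∑ j : Fin 2, ∑ k : Fin 2,
        ‖((N (embIter (K - n) y) - V y * (((frameAccU (K - n) (bgUnits F K U₀) (bgUnits F K U') y)⁻¹ : (Matrix (Fin 2) (Fin 2) ℂ)ˣ) : Matrix (Fin 2) (Fin 2) ℂ)) - ns (K - n) y) j k‖ ^ 2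
        ≤ 2 * δT ^ 2 * ‖toL2S F K c₀ N‖ ^ 2 ∧
      Real.sqrt (c₀ * (eta F n K)⁻¹ ^ 3 * ∑ y : Site (F.P K) (K - n), ∑ j : Fin 2, ∑ k : Fin 2,
        ‖((N (embIter (K - n) y) - V y * (((frameAccU (K - n) (bgUnits F K U₀) (bgUnits F K U') y)⁻¹ : (Matrix (Fin 2) (Fin 2) ℂ)ˣ) : Matrix (Fin 2) (Fin 2) ℂ)) - ns (K - n) y) j k‖ ^ 2)
        ≤ Real.sqrt 2 * δT * ‖toL2S F K c₀ N‖ := by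
  have hpt := norm_frameResponse_sub_avgSeq_le_of_plaqSmall F hε₀ he hWe hWε hε₀' hε' U₀ U' hreg hplaq' A₁ hA₁ hU' hg0 hgd ns h0 hsucc hV hδT
  have hL3 : (3 : ℝ) ≤ F.L := by
    have hL3 : 3 ≤ F.L := by obtain ⟨a, ha⟩ := F.hL.1; have := F.hL.2; omega
    exact_mod_cast hL3
  have hL1 : (0 : ℝ) < (F.L : ℝ) - 1 := by linarith
  have hδT0 : 0 ≤ δT := le_trans (div_nonneg (by positivity) hL1.le) hδT
  exact ⟨crs_le_of_blockRMS F (c₀ := c₀) N _ hpt, sqrt_crs_le_of_blockRMS F (c₀ := c₀) N _ hδT0 hpt⟩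

/-- ★★ **R2t ON THE SECTOR «the nested mean ends at `0`» — THE ROW `hKT` OF ✓`Prop7LandauTransversalityPairing.hS_of_rowsZ` VERBATIM IN SIZE** (`Kop N` the displayed coarse field,
`q` the `Real.sqrt` of the currency of record, `δ := √2·δ_T`): if `ns_{K−n} = 0` then `q(𝓚_{A₁}N) ≤ √2·δ_T·(‖toL2S N‖ + ‖D_{U₀}(toL2S N)‖)`.
[cite: Balaban1985BackgroundPropagators, (3.19) p.393, (3.21)-(3.23) p.394; Balaban1985Variational, (45) p.285] -/
theorem sqrt_crs_frameResponse_le_of_plaqSmall_of_avgSeq_eq_zero {ε₀ ε₀' e : ℝ} (hε₀ : 0 < ε₀) (he : 0 < e) (hWe : 10 ^ 9 * (F.L : ℝ) ^ 2 * e ≤ 1)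
    (hWε : 10 ^ 12 * (F.L : ℝ) ^ 3 * ε₀ ≤ 1) (hε₀' : 0 < ε₀') (hε' : 10 ^ 7 * (F.L : ℝ) ^ 3 * ε₀' ≤ 1)
    (U₀ U' : GaugeField (F.P K) 0 (Matrix.specialUnitaryGroup (Fin 2) ℂ)) (hreg : RegPr F n K ε₀ U₀) (hplaq' : PlaqSmall (regThreshold F n K ε₀') U')
    (A₁ : PBond (F.P K) 0 → Matrix (Fin 2) (Fin 2) ℂ) (hA₁ : ‖A₁‖ < e * eta F n K)
    (hU' : ∀ b, ((U' b : Matrix.specialUnitaryGroup (Fin 2) ℂ) : Matrix (Fin 2) (Fin 2) ℂ) = exp (A₁ b) * ((U₀ b : Matrix.specialUnitaryGroup (Fin 2) ℂ) : Matrix (Fin 2) (Fin 2) ℂ))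
    {g : ℝ → Site (F.P K) 0 → (Matrix (Fin 2) (Fin 2) ℂ)ˣ} {N : Site (F.P K) 0 → Matrix (Fin 2) (Fin 2) ℂ} (hg0 : g 0 = fun _ => 1)
    (hgd : ∀ x, HasDerivAt (fun t : ℝ => ((g t x : (Matrix (Fin 2) (Fin 2) ℂ)ˣ) : Matrix (Fin 2) (Fin 2) ℂ)) (N x) 0)
    (ns : (j : ℕ) → Site (F.P K) j → Matrix (Fin 2) (Fin 2) ℂ) (h0 : ns 0 = N)
    (hsucc : ∀ (j : ℕ) (y : Site (F.P K) (j + 1)), ns (j + 1) y = ns j (emb y) - meanCLM (Idx (F.P K)) (Matrix (Fin 2) (Fin 2) ℂ) fun i : Idx (F.P K) =>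
        ns j (emb y) - ((holT (emlIterU j (bgUnits F K U₀)) (emb y) (stairWord i.2.1 (off i.1)) : (Matrix (Fin 2) (Fin 2) ℂ)ˣ) : Matrix (Fin 2) (Fin 2) ℂ) *
          ns j (transl (emb y) (disp (stairWord i.2.1 (off i.1)))) * (((holT (emlIterU j (bgUnits F K U₀)) (emb y) (stairWord i.2.1 (off i.1)))⁻¹ : (Matrix (Fin 2) (Fin 2) ℂ)ˣ) : Matrix (Fin 2) (Fin 2) ℂ))
    (hZ : ∀ y : Site (F.P K) (K - n), ns (K - n) y = 0)
    {V : Site (F.P K) (K - n) → Matrix (Fin 2) (Fin 2) ℂ}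
    (hV : ∀ x : Site (F.P K) (K - n), HasDerivAt (fun t : ℝ => ((frameAccU (K - n) (bgUnits F K U₀) (gaugeActT (g t) (bgUnits F K U')) x : (Matrix (Fin 2) (Fin 2) ℂ)ˣ) : Matrix (Fin 2) (Fin 2) ℂ)) (V x) 0)
    {δT : ℝ} (hδT : 2 * (240 * (F.L : ℝ) + 19560 * (F.L : ℝ) ^ 3) * (2 * e + 2700 * (F.L : ℝ) * ε₀) / ((F.L : ℝ) - 1) ≤ δT)
    {c₀ : ℝ} [Fact (0 < c₀)] :
    Real.sqrt (c₀ * (eta F n K)⁻¹ ^ 3 * ∑ y : Site (F.P K) (K - n), ∑ j : Fin 2, ∑ k : Fin 2,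
        ‖(N (embIter (K - n) y) - V y * (((frameAccU (K - n) (bgUnits F K U₀) (bgUnits F K U') y)⁻¹ : (Matrix (Fin 2) (Fin 2) ℂ)ˣ) : Matrix (Fin 2) (Fin 2) ℂ)) j k‖ ^ 2)
      ≤ Real.sqrt 2 * δT * (‖toL2S F K c₀ N‖ + ‖DL2 F n K c₀ U₀ (toL2S F K c₀ N)‖) := by
  have h := (crs_frameResponse_sub_avgSeq_le_of_plaqSmall F hε₀ he hWe hWε hε₀' hε' U₀ U' hreg hplaq' A₁ hA₁ hU' hg0 hgd ns h0 hsucc hV hδT (c₀ := c₀)).2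
  have hL3 : (3 : ℝ) ≤ F.L := by
    have hL3 : 3 ≤ F.L := by obtain ⟨a, ha⟩ := F.hL.1; have := F.hL.2; omega
    exact_mod_cast hL3
  have hL1 : (0 : ℝ) < (F.L : ℝ) - 1 := by linarith
  have hδT0 : 0 ≤ δT := le_trans (div_nonneg (by positivity) hL1.le) hδT
  simp only [hZ, sub_zero] at h
  exact h.trans (mul_le_mul_of_nonneg_left (le_add_of_nonneg_right (norm_nonneg _)) (by positivity))

section Shift

variable (h : n ≤ K)

/-- ★★ **R2t IN THE (Y1) LETTERS OF THE KNIT** (`Y := SiteL2K ℂ 3 (periodsT3 F n) c₁ W₂`, `Kop N := toL2S F n c₁ ((𝓚_{A₁}N) ∘ siteShift)`, `q := ‖·‖`, `c₁ = c₀·η⁻³`): on the sector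
`ns_{K−n} = 0`, **`‖toL2S F n c₁ ((𝓚_{A₁}N) ∘ siteShift)‖ ≤ √2·δ_T·(‖toL2S F K c₀ N‖ + ‖D_{U₀}(toL2S F K c₀ N)‖)`** — ✓`hS_of_rowsZ`'s `hKT` with `δ := √2·δ_T`, by
`sqrt_crs_frameResponse_le_of_regPr_of_avgSeq_eq_zero` and `normSq_toL2S_shift_eq`. [cite: Balaban1985BackgroundPropagators, (3.11) p.392, (3.19) p.393, (3.21)-(3.23) p.394; Balaban1985Variational, (45) p.285] -/
theorem norm_toL2S_shift_frameResponse_le_of_plaqSmall_of_avgSeq_eq_zero {ε₀ ε₀' e : ℝ} (hε₀ : 0 < ε₀) (he : 0 < e) (hWe : 10 ^ 9 * (F.L : ℝ) ^ 2 * e ≤ 1)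
    (hWε : 10 ^ 12 * (F.L : ℝ) ^ 3 * ε₀ ≤ 1) (hε₀' : 0 < ε₀') (hε' : 10 ^ 7 * (F.L : ℝ) ^ 3 * ε₀' ≤ 1)
    (U₀ U' : GaugeField (F.P K) 0 (Matrix.specialUnitaryGroup (Fin 2) ℂ)) (hreg : RegPr F n K ε₀ U₀) (hplaq' : PlaqSmall (regThreshold F n K ε₀') U')
    (A₁ : PBond (F.P K) 0 → Matrix (Fin 2) (Fin 2) ℂ) (hA₁ : ‖A₁‖ < e * eta F n K)
    (hU' : ∀ b, ((U' b : Matrix.specialUnitaryGroup (Fin 2) ℂ) : Matrix (Fin 2) (Fin 2) ℂ) = exp (A₁ b) * ((U₀ b : Matrix.specialUnitaryGroup (Fin 2) ℂ) : Matrix (Fin 2) (Fin 2) ℂ))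
    {g : ℝ → Site (F.P K) 0 → (Matrix (Fin 2) (Fin 2) ℂ)ˣ} {N : Site (F.P K) 0 → Matrix (Fin 2) (Fin 2) ℂ} (hg0 : g 0 = fun _ => 1)
    (hgd : ∀ x, HasDerivAt (fun t : ℝ => ((g t x : (Matrix (Fin 2) (Fin 2) ℂ)ˣ) : Matrix (Fin 2) (Fin 2) ℂ)) (N x) 0)
    (ns : (j : ℕ) → Site (F.P K) j → Matrix (Fin 2) (Fin 2) ℂ) (h0 : ns 0 = N)
    (hsucc : ∀ (j : ℕ) (y : Site (F.P K) (j + 1)), ns (j + 1) y = ns j (emb y) - meanCLM (Idx (F.P K)) (Matrix (Fin 2) (Fin 2) ℂ) fun i : Idx (F.P K) =>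
        ns j (emb y) - ((holT (emlIterU j (bgUnits F K U₀)) (emb y) (stairWord i.2.1 (off i.1)) : (Matrix (Fin 2) (Fin 2) ℂ)ˣ) : Matrix (Fin 2) (Fin 2) ℂ) *
          ns j (transl (emb y) (disp (stairWord i.2.1 (off i.1)))) * (((holT (emlIterU j (bgUnits F K U₀)) (emb y) (stairWord i.2.1 (off i.1)))⁻¹ : (Matrix (Fin 2) (Fin 2) ℂ)ˣ) : Matrix (Fin 2) (Fin 2) ℂ))
    (hZ : ∀ y : Site (F.P K) (K - n), ns (K - n) y = 0)
    {V : Site (F.P K) (K - n) → Matrix (Fin 2) (Fin 2) ℂ}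
    (hV : ∀ x : Site (F.P K) (K - n), HasDerivAt (fun t : ℝ => ((frameAccU (K - n) (bgUnits F K U₀) (gaugeActT (g t) (bgUnits F K U')) x : (Matrix (Fin 2) (Fin 2) ℂ)ˣ) : Matrix (Fin 2) (Fin 2) ℂ)) (V x) 0)
    {δT : ℝ} (hδT : 2 * (240 * (F.L : ℝ) + 19560 * (F.L : ℝ) ^ 3) * (2 * e + 2700 * (F.L : ℝ) * ε₀) / ((F.L : ℝ) - 1) ≤ δT)
    {c₀ : ℝ} [Fact (0 < c₀)] {c₁ : ℝ} [Fact (0 < c₁)] (hc₁ : c₁ = c₀ * (eta F n K)⁻¹ ^ 3) :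
    ‖toL2S F n c₁ (fun y' : Site (F.P n) 0 =>
        N (embIter (K - n) (siteShift (sites_eq F n K h) y')) - V (siteShift (sites_eq F n K h) y') *
          (((frameAccU (K - n) (bgUnits F K U₀) (bgUnits F K U') (siteShift (sites_eq F n K h) y'))⁻¹ : (Matrix (Fin 2) (Fin 2) ℂ)ˣ) : Matrix (Fin 2) (Fin 2) ℂ))‖
      ≤ Real.sqrt 2 * δT * (‖toL2S F K c₀ N‖ + ‖DL2 F n K c₀ U₀ (toL2S F K c₀ N)‖) := by
  have hsq := normSq_toL2S_shift_eq F h (c₁ := c₁) (fun y : Site (F.P K) (K - n) =>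
    N (embIter (K - n) y) - V y * (((frameAccU (K - n) (bgUnits F K U₀) (bgUnits F K U') y)⁻¹ : (Matrix (Fin 2) (Fin 2) ℂ)ˣ) : Matrix (Fin 2) (Fin 2) ℂ))
  have hcrs := sqrt_crs_frameResponse_le_of_plaqSmall_of_avgSeq_eq_zero F hε₀ he hWe hWε hε₀' hε' U₀ U' hreg hplaq' A₁ hA₁ hU' hg0 hgd ns h0 hsucc hZ hV hδT (c₀ := c₀)
  rw [← hc₁, ← hsq, Real.sqrt_sq (norm_nonneg _)] at hcrs
  exact hcrs

end Shift

/-- ★★★ **ROW-V AT THE T³ MEMBER**: for `U₀ ∈ 𝔘_k(ε₀)` (`10¹²L³ε₀ ≤ 1`), `U′ = e^{A₁}U₀ ∈ 𝔘_k(ε₀′)` (`10⁷L³ε₀′ ≤ 1`), `‖A₁‖ < e·η` (`10⁹L²e ≤ 1`), there is a ℂ-linear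
`V : (Site (F.P K) 0 → M₂) →ₗ[ℂ] (Site (F.P K) (K − n) → M₂)` with `d∕dt|₀ frameAccU (K−n) U₀♭ ((U′♭)^{exp(tN)}) x = V N x` for every `N`, `x` — the `V` letter of the (P2)-KNIT-Y1
(★w5-20520 g7's shape verbatim); `‖τ_j − 1‖ < 1∕3` is ✓`towerData_of_regPr`'s first row (`≤ 60L·c·(Lʲη) ≤ 10⁻⁶`). [cite: Balaban1985Averaging, (97) p.32; Balaban1985BackgroundPropagators, (3.19) p.393; Balaban1985Variational, (2) p.278, (44) p.285] -/
theorem exists_linear_frameResponse_of_plaqSmall {ε₀ ε₀' e : ℝ} (hε₀ : 0 < ε₀) (he : 0 < e) (hWe : 10 ^ 9 * (F.L : ℝ) ^ 2 * e ≤ 1) (hWε : 10 ^ 12 * (F.L : ℝ) ^ 3 * ε₀ ≤ 1)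
    (hε₀' : 0 < ε₀') (hε' : 10 ^ 7 * (F.L : ℝ) ^ 3 * ε₀' ≤ 1)
    (U₀ U' : GaugeField (F.P K) 0 (Matrix.specialUnitaryGroup (Fin 2) ℂ)) (hreg : RegPr F n K ε₀ U₀) (hplaq' : PlaqSmall (regThreshold F n K ε₀') U')
    (A₁ : PBond (F.P K) 0 → Matrix (Fin 2) (Fin 2) ℂ) (hA₁ : ‖A₁‖ < e * eta F n K)
    (hU' : ∀ b, ((U' b : Matrix.specialUnitaryGroup (Fin 2) ℂ) : Matrix (Fin 2) (Fin 2) ℂ) = exp (A₁ b) * ((U₀ b : Matrix.specialUnitaryGroup (Fin 2) ℂ) : Matrix (Fin 2) (Fin 2) ℂ)) :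
    ∃ V : (Site (F.P K) 0 → Matrix (Fin 2) (Fin 2) ℂ) →ₗ[ℂ] (Site (F.P K) (K - n) → Matrix (Fin 2) (Fin 2) ℂ),
      ∀ (N : Site (F.P K) 0 → Matrix (Fin 2) (Fin 2) ℂ) (x : Site (F.P K) (K - n)),
        HasDerivAt (fun t : ℝ => ((frameAccU (K - n) (bgUnits F K U₀) (gaugeActT (fun z : Site (F.P K) 0 => expUnit (t • N z)) (bgUnits F K U')) x :
          (Matrix (Fin 2) (Fin 2) ℂ)ˣ) : Matrix (Fin 2) (Fin 2) ℂ)) (V N x) 0 := by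
  obtain ⟨hτ, -⟩ := towerData_of_plaqSmall F hε₀ he hWe hWε hε₀' hε' U₀ U' hreg hplaq' A₁ hA₁ hU'
  have hL3 : 3 ≤ F.L := by obtain ⟨a, ha⟩ := F.hL.1; have := F.hL.2; omega
  have hL1 : (1 : ℝ) ≤ F.L := by exact_mod_cast (show 1 ≤ F.L by omega)
  have hτ' : ∀ (j : ℕ) (y : Site (F.P K) (j + 1)), j < K - n →
      ‖(fun i : Idx (F.P K) => ((tstairU (emlIterU j (bgUnits F K U₀)) (dbarCovIterU j (bgUnits F K U₀) (bgUnits F K U')) y i : (Matrix (Fin 2) (Fin 2) ℂ)ˣ) :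
        Matrix (Fin 2) (Fin 2) ℂ)) - 1‖ < 1 / 3 := by
    intro j y hj
    refine (hτ j y hj).trans_lt ?_
    have hX : (F.L : ℝ) ^ j * eta F n K ≤ 1 := Prop7SymAvgTwSym.pow_mul_eta_le_one F hj.le
    have hu : (F.L : ℝ) ^ 2 * e ≤ 1 / 10 ^ 9 := by rw [le_div_iff₀ (by positivity)]; linarith
    have hv : (F.L : ℝ) ^ 3 * ε₀ ≤ 1 / 10 ^ 12 := by rw [le_div_iff₀ (by positivity)]; linarith
    have h1 : (F.L : ℝ) * e ≤ (F.L : ℝ) ^ 2 * e := mul_le_mul_of_nonneg_right (le_self_pow₀ hL1 two_ne_zero) he.le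
    have h2 : (F.L : ℝ) ^ 2 * ε₀ ≤ (F.L : ℝ) ^ 3 * ε₀ := mul_le_mul_of_nonneg_right (pow_le_pow_right₀ hL1 (by norm_num)) hε₀.le
    have hη : 0 < eta F n K := eta_pos F n K
    calc 60 * (F.L : ℝ) * ((2 * e + 2700 * (F.L : ℝ) * ε₀) * ((F.L : ℝ) ^ j * eta F n K))
        ≤ 60 * (F.L : ℝ) * ((2 * e + 2700 * (F.L : ℝ) * ε₀) * 1) := by gcongr
      _ = 120 * ((F.L : ℝ) * e) + 162000 * ((F.L : ℝ) ^ 2 * ε₀) := by ring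
      _ < 1 / 3 := by linarith
  exact exists_linear_frameResponse (bgUnits F K U₀) (bgUnits F K U') (K - n) hτ' (K - n) le_rfl

end Summit.QuantumFields.YangMills.Theorems.Prop7FrameCorrectedMinusMean

end
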